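import Mathlib
import Summits.QuantumFields.BalabanUV.Beta.UnitLatticeOmegaBudgets

/-!
# `Summit.QuantumFields.BalabanUV.Beta.UnitLatticeProfiles` — THE LATTICE PROFILES AS NUMBERS: for sites `e : Y → ℤ^ν`
# embedded INJECTIVELY, `Σ_j e^{−a·supDist(e i, e j)} ≤ (2/(1 − e^{−a/ν}))^ν` and
# `Σ_j supDist·e^{−a·supDist} ≤ (e·b)⁻¹·(2/(1 − e^{−(a−b)/ν}))^ν` (`0 < b < a`) — VOLUME-FREE, so the profile hypotheses
# `hL`, `hL₁` of the lineage's walk-inversion ∕ local-inverse ∕ box ENDs are numbers of `ℤ^ν`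

HONEST FRAMING (page 1 of everything in this cell).  Discharging `FlowStep.BetaPertH` would make Bałaban's ultraviolet
stability UNCONDITIONAL — a constructive-QFT result; NOT the continuum limit, NOT the Clay problem.  This module
discharges nothing of `BetaPertH`; [folklore] lattice sums, kernel-checked (unit `b2b-balaban-beta-d4-p3`, road P3, gen 5;
skeleton v1.12 §7.9).  The bounds are crude (`e^{−a‖z‖_∞} ≤ Π_i e^{−(a/ν)|z_i|}`, each signed half-line summed
geometrically) — constants, not rates, are lost; nothing printed is involved.  NOT summit progress.
HONEST DEPENDENCY: continuum YM on T⁴ ⇐ BetaPertH ∧ nine spine estimates (0/9 proved); BetaPertH ⇐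
(D1) ∧ (D4) ∧ CAP+tail; G-an2-4 gates asym, D1 and NE2/3/4.

CONTENTS (0 sorry).  §1 `sum_pow_natAbs_le` (any finite `S ⊆ ℤ`: `Σ_{t∈S} q^{|t|} ≤ 2(1 − q)⁻¹`), `sum_prod_pow_natAbs_le`
(any finite `T ⊆ ℤ^ν`: `Σ_{z∈T} Π_i q^{|z_i|} ≤ (2(1 − q)⁻¹)^ν`), `exp_supDist_le_prod`.  §2 **`profile_zero_le`**,
**`profile_one_le`** (the two profiles of `supDistOn e` for injective `e`, uniformly in the site `i` and in `Y`).
§3 numeric sanity.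
-/

open scoped BigOperators
open Finset

namespace Summit.QuantumFields.BalabanUV.Beta.UnitLatticeProfiles

open Summit.QuantumFields.BalabanUV.Beta.UnitLatticeTubeCount (supDist supDistOn supDist_le_iff)
open Summit.QuantumFields.BalabanUV.Beta.UnitLatticeOmegaBudgets (le_exp_mul_div)

noncomputable section

variable {ν : ℕ}

/-! ## §1 Geometric lattice sums -/

/-- On a set of integers of ONE sign, `t ↦ |t|` is injective, so `Σ q^{|t|} ≤ Σ'_n qⁿ = (1 − q)⁻¹`. [folklore] -/
theorem sum_pow_natAbs_le_of_injOn {q : ℝ} (hq0 : 0 ≤ q) (hq1 : q < 1) (S : Finset ℤ)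
    (hinj : Set.InjOn Int.natAbs (S : Set ℤ)) : ∑ t ∈ S, q ^ t.natAbs ≤ (1 - q)⁻¹ := by
  rw [← Finset.sum_image (f := fun n : ℕ => q ^ n) (fun x hx y hy h => hinj hx hy h),
    ← tsum_geometric_of_lt_one hq0 hq1]
  exact (summable_geometric_of_lt_one hq0 hq1).sum_le_tsum _ (fun n _ => pow_nonneg hq0 n)

/-- **Any finite set of integers**: `Σ_{t∈S} q^{|t|} ≤ 2·(1 − q)⁻¹` (`0 ≤ q < 1`; split by sign). [folklore] -/
theorem sum_pow_natAbs_le {q : ℝ} (hq0 : 0 ≤ q) (hq1 : q < 1) (S : Finset ℤ) :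
    ∑ t ∈ S, q ^ t.natAbs ≤ 2 * (1 - q)⁻¹ := by
  rw [← Finset.sum_filter_add_sum_filter_not S (fun t => 0 ≤ t)]
  have h1 : ∑ t ∈ S.filter (fun t => 0 ≤ t), q ^ t.natAbs ≤ (1 - q)⁻¹ := by
    refine sum_pow_natAbs_le_of_injOn hq0 hq1 _ fun x hx y hy h => ?_
    rw [Finset.coe_filter] at hx hy
    exact Int.natAbs_inj_of_nonneg_of_nonneg hx.2 hy.2 |>.1 h
  have h2 : ∑ t ∈ S.filter (fun t => ¬ 0 ≤ t), q ^ t.natAbs ≤ (1 - q)⁻¹ := by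
    refine sum_pow_natAbs_le_of_injOn hq0 hq1 _ fun x hx y hy h => ?_
    rw [Finset.coe_filter] at hx hy
    exact Int.natAbs_inj_of_nonpos_of_nonpos (le_of_lt (not_le.1 hx.2)) (le_of_lt (not_le.1 hy.2)) |>.1 h
  linarith

/-- **Any finite set of lattice points**: `Σ_{z∈T} Π_i q^{|z_i|} ≤ (2(1 − q)⁻¹)^ν` (enlarge `T` to the product of its
coordinate projections; `Finset.prod_univ_sum`). [folklore] -/
theorem sum_prod_pow_natAbs_le {q : ℝ} (hq0 : 0 ≤ q) (hq1 : q < 1) (T : Finset (Fin ν → ℤ)) :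
    ∑ z ∈ T, ∏ i, q ^ (z i).natAbs ≤ (2 * (1 - q)⁻¹) ^ ν := by
  classical
  have hsub : T ⊆ Fintype.piFinset fun i => T.image fun z => z i := by
    intro z hz
    rw [Fintype.mem_piFinset]
    exact fun i => Finset.mem_image.2 ⟨z, hz, rfl⟩
  calc ∑ z ∈ T, ∏ i, q ^ (z i).natAbs
      ≤ ∑ z ∈ Fintype.piFinset (fun i => T.image fun z => z i), ∏ i, q ^ (z i).natAbs :=
        Finset.sum_le_sum_of_subset_of_nonneg hsub fun z _ _ => Finset.prod_nonneg fun i _ => pow_nonneg hq0 _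
    _ = ∏ i : Fin ν, ∑ t ∈ T.image (fun z => z i), q ^ t.natAbs := by
        rw [Finset.prod_univ_sum]
    _ ≤ ∏ _i : Fin ν, 2 * (1 - q)⁻¹ :=
        Finset.prod_le_prod (fun i _ => Finset.sum_nonneg fun t _ => pow_nonneg hq0 _)
          fun i _ => sum_pow_natAbs_le hq0 hq1 _
    _ = (2 * (1 - q)⁻¹) ^ ν := by simp

/-- **Sup-norm below the coordinate product**: `e^{−a·supDist(z,0)} ≤ Π_i (e^{−a/ν})^{|z_i|}` for `a ≥ 0`, `ν ≥ 1`
(since `Σ_i |z_i| ≤ ν·supDist(z, 0)`). [folklore] -/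
theorem exp_supDist_le_prod (hν : 0 < ν) {a : ℝ} (ha : 0 ≤ a) (z : Fin ν → ℤ) :
    Real.exp (-(a * supDist z 0)) ≤ ∏ i, Real.exp (-(a / ν)) ^ (z i).natAbs := by
  have hprod : ∏ i, Real.exp (-(a / ν)) ^ (z i).natAbs = Real.exp (-(a / ν) * ∑ i, ((z i).natAbs : ℝ)) := by
    rw [Finset.mul_sum, Real.exp_sum]
    refine Finset.prod_congr rfl fun i _ => ?_
    rw [← Real.exp_nat_mul]; ring_nf
  rw [hprod]
  refine Real.exp_le_exp.2 ?_
  have hle : ∀ i, ((z i).natAbs : ℝ) ≤ (supDist z 0 : ℝ) := fun i => by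
    have := (supDist_le_iff.1 (le_refl (supDist z 0))) i
    simp only [Pi.zero_apply, sub_zero] at this
    exact_mod_cast this
  have hsum : ∑ i, ((z i).natAbs : ℝ) ≤ ν * (supDist z 0 : ℝ) := by
    calc ∑ i, ((z i).natAbs : ℝ) ≤ ∑ _i : Fin ν, (supDist z 0 : ℝ) := Finset.sum_le_sum fun i _ => hle i
      _ = ν * (supDist z 0 : ℝ) := by simp
  have hν' : (0 : ℝ) < ν := by exact_mod_cast hν
  have : a / ν * ∑ i, ((z i).natAbs : ℝ) ≤ a * supDist z 0 := by
    calc a / ν * ∑ i, ((z i).natAbs : ℝ) ≤ a / ν * (ν * (supDist z 0 : ℝ)) :=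
          mul_le_mul_of_nonneg_left hsum (div_nonneg ha hν'.le)
      _ = a * supDist z 0 := by field_simp
  linarith

/-! ## §2 The two profiles of an injectively embedded unit lattice -/

section Profiles

variable {Y : Type*} [Fintype Y]

omit [Fintype Y] in
/-- `supDistOn e i j = supDist (e j − e i) 0`. [folklore] -/
theorem supDistOn_eq_supDist_sub (e : Y → (Fin ν → ℤ)) (i j : Y) :
    supDistOn e i j = (supDist (e j - e i) 0 : ℝ) := by
  have h : supDist (e i) (e j) = supDist (e j - e i) 0 := by
    unfold supDist
    refine Finset.sup_congr rfl fun k _ => ?_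
    simp only [Pi.sub_apply, Pi.zero_apply, sub_zero]
    rw [← Int.natAbs_neg, neg_sub]
  unfold supDistOn
  rw [h]

/-- **ZEROTH PROFILE**: for INJECTIVE `e` and `a > 0`, `Σ_j e^{−a·supDistOn e i j} ≤ (2(1 − e^{−a/ν})⁻¹)^ν` for every site `i`
— uniformly in `i` and in the (finite) volume `Y`. [folklore] -/
theorem profile_zero_le (hν : 0 < ν) (e : Y → (Fin ν → ℤ)) (he : Function.Injective e) {a : ℝ} (ha : 0 < a)
    (i : Y) : ∑ j, Real.exp (-(a * supDistOn e i j)) ≤ (2 * (1 - Real.exp (-(a / ν)))⁻¹) ^ ν := by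
  classical
  set q := Real.exp (-(a / ν)) with hq
  have hq0 : 0 ≤ q := (Real.exp_pos _).le
  have hq1 : q < 1 := Real.exp_lt_one_iff.2 (by
    have hν' : (0 : ℝ) < ν := by exact_mod_cast hν
    exact neg_neg_of_pos (div_pos ha hν'))
  set w : Y → (Fin ν → ℤ) := fun j => e j - e i with hw
  have hwinj : Function.Injective w := fun j j' h => he (sub_left_injective h)
  calc ∑ j, Real.exp (-(a * supDistOn e i j))
      ≤ ∑ j, ∏ k, q ^ (w j k).natAbs := Finset.sum_le_sum fun j _ => by
        rw [supDistOn_eq_supDist_sub]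
        exact exp_supDist_le_prod hν ha.le (e j - e i)
    _ = ∑ z ∈ Finset.univ.image w, ∏ k, q ^ (z k).natAbs := by
        rw [Finset.sum_image fun x _ y _ h => hwinj h]
    _ ≤ (2 * (1 - q)⁻¹) ^ ν := sum_prod_pow_natAbs_le hq0 hq1 _

/-- **FIRST PROFILE**: for INJECTIVE `e` and `0 < b < a`,
`Σ_j supDistOn e i j · e^{−a·supDistOn e i j} ≤ (e·b)⁻¹·(2(1 − e^{−(a−b)/ν})⁻¹)^ν` (one power of the distance costs the
rate `b`: `t ≤ e^{bt}/(eb)`). [folklore] -/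
theorem profile_one_le (hν : 0 < ν) (e : Y → (Fin ν → ℤ)) (he : Function.Injective e) {a b : ℝ} (hb : 0 < b)
    (hab : b < a) (i : Y) :
    ∑ j, supDistOn e i j * Real.exp (-(a * supDistOn e i j))
      ≤ (Real.exp 1 * b)⁻¹ * (2 * (1 - Real.exp (-((a - b) / ν)))⁻¹) ^ ν := by
  have hterm : ∀ j, supDistOn e i j * Real.exp (-(a * supDistOn e i j))
      ≤ (Real.exp 1 * b)⁻¹ * Real.exp (-((a - b) * supDistOn e i j)) := by
    intro j
    have h1 : supDistOn e i j ≤ Real.exp (b * supDistOn e i j) / (Real.exp 1 * b) := le_exp_mul_div hb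
    calc supDistOn e i j * Real.exp (-(a * supDistOn e i j))
        ≤ Real.exp (b * supDistOn e i j) / (Real.exp 1 * b) * Real.exp (-(a * supDistOn e i j)) :=
          mul_le_mul_of_nonneg_right h1 (Real.exp_pos _).le
      _ = (Real.exp 1 * b)⁻¹ * (Real.exp (b * supDistOn e i j) * Real.exp (-(a * supDistOn e i j))) := by
          rw [div_eq_mul_inv]; ring
      _ = (Real.exp 1 * b)⁻¹ * Real.exp (-((a - b) * supDistOn e i j)) := by
          rw [← Real.exp_add]; ring_nf
  calc ∑ j, supDistOn e i j * Real.exp (-(a * supDistOn e i j))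
      ≤ ∑ j, (Real.exp 1 * b)⁻¹ * Real.exp (-((a - b) * supDistOn e i j)) := Finset.sum_le_sum fun j _ => hterm j
    _ = (Real.exp 1 * b)⁻¹ * ∑ j, Real.exp (-((a - b) * supDistOn e i j)) := by rw [Finset.mul_sum]
    _ ≤ (Real.exp 1 * b)⁻¹ * (2 * (1 - Real.exp (-((a - b) / ν)))⁻¹) ^ ν :=
        mul_le_mul_of_nonneg_left (profile_zero_le hν e he (sub_pos.2 hab) i) (by positivity)

end Profiles

/-! ## §3 Numeric sanity -/

/-- The one-dimensional bound at `q = 1/2` on `{−1, 0, 1}`: `½ + 1 + ½ = 2 ≤ 2·(1 − ½)⁻¹ = 4`. [folklore] -/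
example : ∑ t ∈ ({-1, 0, 1} : Finset ℤ), (1 / 2 : ℝ) ^ t.natAbs ≤ 2 * (1 - 1 / 2)⁻¹ :=
  sum_pow_natAbs_le (by norm_num) (by norm_num) _

end

end Summit.QuantumFields.BalabanUV.Beta.UnitLatticeProfiles
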